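/-
COR-CM (cell pub-hodgecm2, stage 2 of the Hodge ladder) — count-neutral KERNEL COMBINATORICS «the MARKMAN COLUMN of the census
transport, generic part» (seat prover-pub-hodgecm2-b23-g34-0, binder prover b23, gen 34; own lane DEG12-MARKMAN-TRANSPORT,
HOME/LIT-CLAIMS.md l.1451, HOME/INBOX.md l.5632; sequel of `CorCM/FaceCensusTransport.lean` (b23) and of seat b09's
`CorCM/FaceCensusKnownProducts.lean` / `Census/DecicFaceTransportOfMarkman.lean`, whose one-weight bookkeeping (§1 there) is made
generic here).  Theorems only; no geometry, no `Universe`, no definition, no named fact, nothing asserted; `Interfaces.lean` (C1), every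
E term, `B01/*`, `Transposition/*` untouched.  HONEST FRAMING: `HC_CM` is NOT proved; nothing here concerns any particular field.
T5: no hypothesis binder of Prop sort besides code readings / module memberships (all inhabited, `exists_type_reads`); n/a-class.
-/
import Summits.HodgeConjecture.CorCM.FaceCensusKnownProducts
import Summits.HodgeConjecture.CorCM.FaceCensusTransport
import HarnessLib

/-!
# The Markman column of the census transport (generic): code-read Hodge weights on products, and certificates using them

The enlarged face transport (`CorCM/FacePeriodsKnownProducts.lean`, seat b09) allows, besides the Weil characters of a set `𝒮` of
faces, the Lefschetz characters `lefChar Θ′ S′` of the Hodge weights `S′` of a set `𝒲` of families `Θ′` of CM types whose product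
has a KNOWN Hodge conjecture.  In the census currency (`CorCM/FaceCensusTransport.lean`) a face `f` is then eliminated from a
generating set by a PRE-QUOTIENT certificate

  `1_{corners f} − Σ_m c_m · r(e_{S′_m}) = Σ_i c_i · 1_{corners g_i} + Σ_j d_j · 1_{{P_j, P̄_j}}`      (exponent vectors on CM types),

`g_i` in the orbit cells of the kept representatives, `r(e_{S′}) = weightRel Θ′ S′`.  This file supplies, for ANY census type
`(Γ, e)`, the bookkeeping that turns such an identity — a closed `decide` over the type codes in the per-type files — into
`weightRel f.corner (· ↦ {σ₀}) ∈ span ℤ Y(𝒮, 𝒲) ⊔ pairRel`: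

* §1 codes of a type READ AS `T` at `σ₀` and at the translates `(e⁻¹ u)⁻¹ σ₀` (code `Γ.twist u T`); every CM-type code is read by
  some tree type (`exists_type_reads`, non-vacuity of the reading binders);
* §2 TWO-SLOT WEIGHTS IN LIST FORM: on a family `![Θ_E, Θ_T]` reading as `(T_E, T_T)` the weight
  `S′ = ![{(e⁻¹u)⁻¹σ₀ : u ∈ us_E}, {(e⁻¹u)⁻¹σ₀ : u ∈ us_T}]` EVALUATES at a type of code `S` to
  `Σ_{u ∈ us_E} [S = Γ.twist u T_E] + Σ_{u ∈ us_T} [S = Γ.twist u T_T]` (`weightRel_pair_apply`) and IS A HODGE WEIGHT of degree `p`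
  as soon as the closed check `∀ i, Σ [i ∈ Γ.twist u T_E] + Σ [i ∈ Γ.twist u T_T] = p` holds (`isHodgeWeight_pair_of_check`) —
  the Weil-fourfold weights `E_a × T_j` of the degree-12 Markman column are of this shape with `|us_E| = 1`, `|us_T| = 3`, `p = 2`;
* §3 the module bookkeeping: multiples of known-product weight relations lie in the enlarged module, and
  `x − y ∈ span(faces) ⊔ pairRel`, `y ∈ span Y(𝒮, 𝒲) ⊔ pairRel` ⟹ `x ∈ span Y(𝒮, 𝒲) ⊔ pairRel` (`mem_known_of_sub_mem`);
* §4 the decidable side checks of a certificate (orbit cells, pair labels) in the `Bool` form the per-type files decide.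

References: [QW8] Def. 2.3; [cite: Pohlmann1968, Thm. 1]; [cite: Milne1999LefschetzClasses, Thm. 3.2].
-/

noncomputable section

open NumberField NumberField.ComplexEmbedding

namespace Summit.HodgeConjecture.CorCM.FaceCensus

open Literature.AlgebraicGeometry.Motives (CMType)
open Literature.NumberTheory.ComplexMultiplication.CMTypeOps
open Summit.HodgeConjecture.CorCM.Prior.AllgGroup.RfwfAllgGroup
open Summit.HodgeConjecture.CorCM.Census.FaceSquaresModel

variable {F : Type} [Field F] [NumberField F] {n : ℕ} (Γ : CMGaloisType n) (e : GalT F ≃ Fin n)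

/-! ## §1 Types read through codes -/

omit Γ in
/-- Code of a type READ AS `T` at `σ₀` through `e` (the code of `pullType Θ σ₀`). [folklore] -/
theorem code_of_reads (σ₀ : F →+* ℂ) (Θ : CMType F) {T : ℕ} (hT : T < 2 ^ n)
    (h : ∀ P : GalT F, P.1 σ₀ ∈ Θ.1 ↔ mem (e P) T = true) :
    T < 2 ^ n ∧ ∀ i : Fin n, mem i T = true ↔ e.symm i ∈ (pullType Θ σ₀).1 :=
  ⟨hT, fun i => by rw [mem_pullType, h, e.apply_symm_apply]⟩

omit Γ in
/-- Conversely, a code of `pullType Θ σ₀` is a reading of `Θ` at `σ₀`. [folklore] -/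
theorem reads_of_code (σ₀ : F →+* ℂ) (Θ : CMType F) {T : ℕ}
    (h : T < 2 ^ n ∧ ∀ i : Fin n, mem i T = true ↔ e.symm i ∈ (pullType Θ σ₀).1) (P : GalT F) :
    P.1 σ₀ ∈ Θ.1 ↔ mem (e P) T = true := by
  rw [← mem_pullType, ← e.symm_apply_apply P, ← h.2 (e P), e.symm_apply_apply]

omit Γ in
/-- A single abstract type evaluates through its code. [folklore] -/
theorem single_apply_code {X Ψ : CMF (GalT F) conjT} {T S : ℕ}
    (hX : T < 2 ^ n ∧ ∀ i : Fin n, mem i T = true ↔ e.symm i ∈ X.1)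
    (hS : S < 2 ^ n ∧ ∀ i : Fin n, mem i S = true ↔ e.symm i ∈ Ψ.1) :
    (Finsupp.single X (1 : ℤ)) Ψ = if S = T then 1 else 0 := by
  rw [Finsupp.single_apply]
  by_cases h : X = Ψ
  · rw [if_pos h, if_pos ((eq_iff_code_eq e hX hS).mp h).symm]
  · rw [if_neg h, if_neg (fun h' => h ((eq_iff_code_eq e hX hS).mpr h'.symm))]

/-- **Code of a type read at the translate `(e⁻¹ u)⁻¹ σ₀`**: `Γ.twist u T` (`code_pullType_baseChange`). [folklore] -/
theorem code_reads_translate (hmul : ∀ P Q : GalT F, e (P * Q) = Γ.mul (e P) (e Q)) (σ₀ : F →+* ℂ) (Θ : CMType F)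
    {T : ℕ} (hT : T < 2 ^ n) (hΘ : ∀ P : GalT F, P.1 σ₀ ∈ Θ.1 ↔ mem (e P) T = true) (u : Fin n) :
    Γ.twist u T < 2 ^ n ∧
      ∀ i : Fin n, mem i (Γ.twist u T) = true ↔ e.symm i ∈ (pullType Θ (((e.symm u)⁻¹).1 σ₀)).1 := by
  have h := code_pullType_baseChange Γ e hmul Θ σ₀ (e.symm u)⁻¹ (code_of_reads e σ₀ Θ hT hΘ)
  rwa [inv_inv, e.apply_symm_apply] at h

omit Γ in
/-- The translates `(e⁻¹ u)⁻¹ σ₀` are pairwise distinct (the action of `GalT F` on embeddings is free). [folklore] -/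
theorem translateInv_injective [IsGalois ℚ F] (σ₀ : F →+* ℂ) :
    Function.Injective (fun u : Fin n => ((e.symm u)⁻¹).1 σ₀) := by
  intro u u' h
  have h' : (e.symm u)⁻¹ = (e.symm u')⁻¹ := GalT.ext_of_apply σ₀ h
  exact e.symm.injective (inv_injective h')

/-- **Non-vacuity of the reading binders**: every CM-type code of the model is READ by some CM type of `F` at `σ₀`. [folklore] -/
theorem exists_type_reads [IsGalois ℚ F] (hmul : ∀ P Q : GalT F, e (P * Q) = Γ.mul (e P) (e Q)) (hconj : e conjT = Γ.conj)
    (σ₀ : F →+* ℂ) {T : ℕ} (hT : Γ.isCMType T = true) :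
    ∃ Θ : CMType F, ∀ P : GalT F, P.1 σ₀ ∈ Θ.1 ↔ mem (e P) T = true := by
  obtain ⟨Ψ₀, h₀⟩ := exists_of_isCMType Γ e hmul hconj hT
  refine ⟨pushType σ₀ Ψ₀, fun P => ?_⟩
  have h := h₀.2 (e P)
  rw [e.symm_apply_apply] at h
  have hm := mem_pullType (pushType σ₀ Ψ₀) σ₀ P
  rw [pullType_pushType] at hm
  rw [← hm]
  exact h.symm

/-! ## §2 Two-slot weights in list form: evaluation through codes and the Hodge check -/

open scoped Classical in
/-- **A two-slot list weight EVALUATES through the codes.**  `Θ_E`, `Θ_T` read as `T_E`, `T_T` at `σ₀`; the weight with slots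
`{(e⁻¹u)⁻¹σ₀ : u ∈ us_E}`, `{(e⁻¹u)⁻¹σ₀ : u ∈ us_T}` (duplicate-free lists) has weight relation evaluating at a type of code `S` to
`Σ_{u ∈ us_E} [S = Γ.twist u T_E] + Σ_{u ∈ us_T} [S = Γ.twist u T_T]`. [cite: Pohlmann1968, Thm. 1] -/
theorem weightRel_pair_apply [IsGalois ℚ F] (hmul : ∀ P Q : GalT F, e (P * Q) = Γ.mul (e P) (e Q)) (σ₀ : F →+* ℂ)
    (ΘE ΘT : CMType F) {TE TT : ℕ} (hTE : TE < 2 ^ n) (hTT : TT < 2 ^ n)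
    (hE : ∀ P : GalT F, P.1 σ₀ ∈ ΘE.1 ↔ mem (e P) TE = true) (hT : ∀ P : GalT F, P.1 σ₀ ∈ ΘT.1 ↔ mem (e P) TT = true)
    (usE usT : List (Fin n)) (hnd : usE.Nodup ∧ usT.Nodup)
    (Ψ : CMF (GalT F) conjT) {S : ℕ} (hS : S < 2 ^ n ∧ ∀ i : Fin n, mem i S = true ↔ e.symm i ∈ Ψ.1) :
    weightRel ![ΘE, ΘT]
        ![(usE.map fun u => ((e.symm u)⁻¹).1 σ₀).toFinset, (usT.map fun u => ((e.symm u)⁻¹).1 σ₀).toFinset] Ψ =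
      (usE.map fun u => if S = Γ.twist u TE then (1 : ℤ) else 0).sum +
        (usT.map fun u => if S = Γ.twist u TT then (1 : ℤ) else 0).sum := by
  classical
  have hndE : (usE.map fun u => ((e.symm u)⁻¹).1 σ₀).Nodup := hnd.1.map (translateInv_injective e σ₀)
  have hndT : (usT.map fun u => ((e.symm u)⁻¹).1 σ₀).Nodup := hnd.2.map (translateInv_injective e σ₀)
  unfold weightRel
  rw [Finsupp.finsetSum_apply, Fin.sum_univ_two]
  simp only [Matrix.cons_val_zero, Matrix.cons_val_one, Finsupp.finsetSum_apply]
  rw [List.sum_toFinset _ hndE, List.sum_toFinset _ hndT, List.map_map, List.map_map]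
  congr 1
  · refine congrArg List.sum (List.map_congr_left fun u _ => ?_)
    exact single_apply_code e (code_reads_translate Γ e hmul σ₀ ΘE hTE hE u) hS
  · refine congrArg List.sum (List.map_congr_left fun u _ => ?_)
    exact single_apply_code e (code_reads_translate Γ e hmul σ₀ ΘT hTT hT u) hS

open scoped Classical in
/-- **A two-slot list weight IS A HODGE WEIGHT of degree `p`** as soon as `|us_E| + |us_T| = 2p` and the closed check
`∀ i, Σ_{u ∈ us_E} [i ∈ Γ.twist u T_E] + Σ_{u ∈ us_T} [i ∈ Γ.twist u T_T] = p` holds (every Galois translate of the monomial has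
Hodge type `(p,p)`, read through the codes). [cite: Pohlmann1968, Thm. 1] -/
theorem isHodgeWeight_pair_of_check [IsGalois ℚ F] (hmul : ∀ P Q : GalT F, e (P * Q) = Γ.mul (e P) (e Q)) (σ₀ : F →+* ℂ)
    (ΘE ΘT : CMType F) {TE TT : ℕ} (hTE : TE < 2 ^ n) (hTT : TT < 2 ^ n)
    (hE : ∀ P : GalT F, P.1 σ₀ ∈ ΘE.1 ↔ mem (e P) TE = true) (hT : ∀ P : GalT F, P.1 σ₀ ∈ ΘT.1 ↔ mem (e P) TT = true)
    (usE usT : List (Fin n)) (hnd : usE.Nodup ∧ usT.Nodup) {p : ℕ} (hlen : usE.length + usT.length = 2 * p)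
    (hchk : ∀ i : Fin n, (usE.map fun u => if mem i (Γ.twist u TE) = true then (1 : ℤ) else 0).sum +
      (usT.map fun u => if mem i (Γ.twist u TT) = true then (1 : ℤ) else 0).sum = p) :
    IsHodgeWeight ![ΘE, ΘT] p
      ![(usE.map fun u => ((e.symm u)⁻¹).1 σ₀).toFinset, (usT.map fun u => ((e.symm u)⁻¹).1 σ₀).toFinset] := by
  classical
  have hndE : (usE.map fun u => ((e.symm u)⁻¹).1 σ₀).Nodup := hnd.1.map (translateInv_injective e σ₀)
  have hndT : (usT.map fun u => ((e.symm u)⁻¹).1 σ₀).Nodup := hnd.2.map (translateInv_injective e σ₀)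
  refine ⟨?_, fun P => ?_⟩
  · rw [Fin.sum_univ_two]
    simp only [Matrix.cons_val_zero, Matrix.cons_val_one]
    rw [List.toFinset_card_of_nodup hndE, List.toFinset_card_of_nodup hndT, List.length_map, List.length_map, hlen]
  · rw [Fin.sum_univ_two]
    simp only [Matrix.cons_val_zero, Matrix.cons_val_one]
    rw [List.sum_toFinset _ hndE, List.sum_toFinset _ hndT, List.map_map, List.map_map, ← hchk (e P)]
    have hu : ∀ (Θ : CMType F) {T : ℕ} (hT' : T < 2 ^ n) (hΘ : ∀ P : GalT F, P.1 σ₀ ∈ Θ.1 ↔ mem (e P) T = true)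
        (u : Fin n), ind Θ (P.1 (((e.symm u)⁻¹).1 σ₀)) = if mem (e P) (Γ.twist u T) = true then 1 else 0 := by
      intro Θ T hT' hΘ u
      have hc := (code_reads_translate Γ e hmul σ₀ Θ hT' hΘ u).2 (e P)
      rw [e.symm_apply_apply, mem_pullType] at hc
      unfold ind
      congr 1
      exact propext hc.symm
    congr 1
    · exact congrArg List.sum (List.map_congr_left fun u _ => hu ΘE hTE hE u)
    · exact congrArg List.sum (List.map_congr_left fun u _ => hu ΘT hTT hT u)

/-! ## §3 Module bookkeeping for certificates with known products -/

omit Γ e in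
/-- **Multiples of a known-product weight relation lie in the enlarged module.** [folklore] -/
theorem zsmul_weightRel_mem_known (𝒮 : Set (Face F)) (𝒲 : Set ((m : ℕ) × (Fin (m + 1) → CMType F)))
    {w : (m : ℕ) × (Fin (m + 1) → CMType F)} (hw : w ∈ 𝒲) {p : ℕ} {S' : Fin (w.1 + 1) → Finset (F →+* ℂ)}
    (hS' : IsHodgeWeight w.2 p S') (c : ℤ) :
    c • weightRel w.2 S' ∈
      Submodule.span ℤ {y : CMF (GalT F) conjT →₀ ℤ |
        (∃ g ∈ 𝒮, ∃ σ : F →+* ℂ, y = weightRel g.corner (fun _ => ({σ} : Finset (F →+* ℂ)))) ∨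
        ∃ w ∈ 𝒲, ∃ (p' : ℕ) (S' : Fin (w.1 + 1) → Finset (F →+* ℂ)), IsHodgeWeight w.2 p' S' ∧ y = weightRel w.2 S'}
        ⊔ pairRel :=
  Submodule.mem_sup_left (Submodule.smul_mem _ c (Submodule.subset_span (Or.inr ⟨w, hw, p, S', hS', rfl⟩)))

omit Γ e in
/-- **Subtraction**: if `x − y` lies in the face module of `𝒮` (with pairs) and `y` in the enlarged module of `(𝒮, 𝒲)`, then `x` lies in
the enlarged module. [folklore] -/
theorem mem_known_of_sub_mem (𝒮 : Set (Face F)) (𝒲 : Set ((m : ℕ) × (Fin (m + 1) → CMType F)))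
    {x y : CMF (GalT F) conjT →₀ ℤ}
    (hxy : x - y ∈ Submodule.span ℤ {y : CMF (GalT F) conjT →₀ ℤ | ∃ g ∈ 𝒮, ∃ σ : F →+* ℂ,
        y = weightRel g.corner (fun _ => ({σ} : Finset (F →+* ℂ)))} ⊔ pairRel)
    (hy : y ∈ Submodule.span ℤ {y : CMF (GalT F) conjT →₀ ℤ |
        (∃ g ∈ 𝒮, ∃ σ : F →+* ℂ, y = weightRel g.corner (fun _ => ({σ} : Finset (F →+* ℂ)))) ∨
        ∃ w ∈ 𝒲, ∃ (p' : ℕ) (S' : Fin (w.1 + 1) → Finset (F →+* ℂ)), IsHodgeWeight w.2 p' S' ∧ y = weightRel w.2 S'}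
        ⊔ pairRel) :
    x ∈ Submodule.span ℤ {y : CMF (GalT F) conjT →₀ ℤ |
        (∃ g ∈ 𝒮, ∃ σ : F →+* ℂ, y = weightRel g.corner (fun _ => ({σ} : Finset (F →+* ℂ)))) ∨
        ∃ w ∈ 𝒲, ∃ (p' : ℕ) (S' : Fin (w.1 + 1) → Finset (F →+* ℂ)), IsHodgeWeight w.2 p' S' ∧ y = weightRel w.2 S'}
        ⊔ pairRel := by
  have hle : Submodule.span ℤ {y : CMF (GalT F) conjT →₀ ℤ | ∃ g ∈ 𝒮, ∃ σ : F →+* ℂ,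
        y = weightRel g.corner (fun _ => ({σ} : Finset (F →+* ℂ)))} ⊔ pairRel ≤
      Submodule.span ℤ {y : CMF (GalT F) conjT →₀ ℤ |
        (∃ g ∈ 𝒮, ∃ σ : F →+* ℂ, y = weightRel g.corner (fun _ => ({σ} : Finset (F →+* ℂ)))) ∨
        ∃ w ∈ 𝒲, ∃ (p' : ℕ) (S' : Fin (w.1 + 1) → Finset (F →+* ℂ)), IsHodgeWeight w.2 p' S' ∧ y = weightRel w.2 S'}
        ⊔ pairRel :=
    sup_le_sup_right (Submodule.span_mono fun y hy => Or.inl hy) _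
  have h := Submodule.add_mem _ (hle hxy) hy
  rwa [sub_add_cancel] at h

/-! ## §4 The decidable side checks of a certificate -/

omit e in
/-- **Orbit cells from the `Bool` check**: every generator face of `fc` lies in one of the eight-face orbit cells of a Galois twist of a
representative of `reps`. [folklore] -/
theorem cells_of_check (reps : List (ℕ × ℕ × ℕ)) (fc : List ((ℕ × ℕ × ℕ) × ℤ))
    (h : (fc.all fun gi => reps.any fun r => (List.finRange n).any fun j =>
      [(Γ.twist j r.1, Γ.twist j r.2.1, Γ.twist j r.2.2),
        (flipAt (Γ.twist j r.2.1) (Γ.twist j r.1), Γ.twist j r.2.1, Γ.twist j r.2.2),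
        (flipAt (Γ.twist j r.2.2) (Γ.twist j r.1), Γ.twist j r.2.1, Γ.twist j r.2.2),
        (flipAt (Γ.twist j r.2.2) (flipAt (Γ.twist j r.2.1) (Γ.twist j r.1)), Γ.twist j r.2.1, Γ.twist j r.2.2),
        (Γ.twist j r.1, Γ.twist j r.2.2, Γ.twist j r.2.1),
        (flipAt (Γ.twist j r.2.1) (Γ.twist j r.1), Γ.twist j r.2.2, Γ.twist j r.2.1),
        (flipAt (Γ.twist j r.2.2) (Γ.twist j r.1), Γ.twist j r.2.2, Γ.twist j r.2.1),
        (flipAt (Γ.twist j r.2.2) (flipAt (Γ.twist j r.2.1) (Γ.twist j r.1)), Γ.twist j r.2.2, Γ.twist j r.2.1)].contains gi.1)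
      = true) :
    ∀ gi ∈ fc, ∃ r ∈ reps, ∃ j : Fin n, gi.1 ∈ [(Γ.twist j r.1, Γ.twist j r.2.1, Γ.twist j r.2.2),
      (flipAt (Γ.twist j r.2.1) (Γ.twist j r.1), Γ.twist j r.2.1, Γ.twist j r.2.2),
      (flipAt (Γ.twist j r.2.2) (Γ.twist j r.1), Γ.twist j r.2.1, Γ.twist j r.2.2),
      (flipAt (Γ.twist j r.2.2) (flipAt (Γ.twist j r.2.1) (Γ.twist j r.1)), Γ.twist j r.2.1, Γ.twist j r.2.2),
      (Γ.twist j r.1, Γ.twist j r.2.2, Γ.twist j r.2.1),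
      (flipAt (Γ.twist j r.2.1) (Γ.twist j r.1), Γ.twist j r.2.2, Γ.twist j r.2.1),
      (flipAt (Γ.twist j r.2.2) (Γ.twist j r.1), Γ.twist j r.2.2, Γ.twist j r.2.1),
      (flipAt (Γ.twist j r.2.2) (flipAt (Γ.twist j r.2.1) (Γ.twist j r.1)), Γ.twist j r.2.2, Γ.twist j r.2.1)] := by
  intro gi hgi
  have h' := List.all_eq_true.mp h gi hgi
  obtain ⟨r, hr, h'⟩ := List.any_eq_true.mp h'
  obtain ⟨j, -, h'⟩ := List.any_eq_true.mp h'
  exact ⟨r, hr, j, List.contains_iff_mem.mp h'⟩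

omit e in
/-- **Pair labels from the `Bool` check**: every pair label of `pc` is a CM type of the model. [folklore] -/
theorem pairs_of_check (pc : List (ℕ × ℤ)) (h : (pc.all fun pj => Γ.isCMType pj.1) = true) :
    ∀ pj ∈ pc, Γ.isCMType pj.1 = true :=
  List.all_eq_true.mp h

/-- **Representatives read in `𝒮`, from the reading form**: a face `R ∈ 𝒮` READ AS `(T; p, q)` at `σ₀` supplies the `hreps` clause of
`mem_of_eval_eq_comboVal` for the representative `(T, p, q)`. [folklore] -/
theorem hreps_of_reads [IsGalois ℚ F] (σ₀ : F →+* ℂ) (𝒮 : Set (Face F)) {R : Face F} (hRS : R ∈ 𝒮) {T p q : ℕ}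
    (hT : T < 2 ^ n)
    (hR : (∀ P : GalT F, P.1 σ₀ ∈ R.Φ.1 ↔ mem (e P) T = true) ∧
      Γ.placeMask (e (translate σ₀ R.p)) = p ∧ Γ.placeMask (e (translate σ₀ R.p')) = q) :
    ∃ R ∈ 𝒮, ((T, p, q).1 < 2 ^ n ∧ ∀ i : Fin n, mem i (T, p, q).1 = true ↔ e.symm i ∈ (pullType R.Φ σ₀).1) ∧
      Γ.placeMask (e (translate σ₀ R.p)) = (T, p, q).2.1 ∧ Γ.placeMask (e (translate σ₀ R.p')) = (T, p, q).2.2 :=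
  ⟨R, hRS, code_of_reads e σ₀ R.Φ hT hR.1, hR.2.1, hR.2.2⟩

end Summit.HodgeConjecture.CorCM.FaceCensus

end
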